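import Summits.PneNP.GCT.Max.KYAllMArithmetic
import Mathlib.Data.Nat.Choose.Cast
import Mathlib.Tactic.IntervalCases
import Mathlib.Tactic.Positivity
import Mathlib.Tactic.Linarith
import Mathlib.Tactic.Ring
import Mathlib.Tactic.FieldSimp
import Mathlib.Tactic.LinearCombination
import HarnessLib
import HarnessLib.Audit

/-!
# `GCT/Max`: the low-`k` arithmetic of the sharper Koszul–Young ceiling, PART 1 of 2 — shapes, glue, casts and the nine
# polynomial inequalities (`m ≥ 5`, `2n ≥ 3m+2`)

Cell `pub-gct-max` (HOME `run/shared/lean/pub/pub-gct-max/`), track F, banked input P4 / W1′a (director-valiant g7, LEAD gen 31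
desk): the pure-arithmetic layer for the LOW-`k` half of the sharper all-`m` ceiling `KYCannotSeparatePaddedPerSharper`
(module `Max/KYSharperAllM`, threshold `2n ≥ 3m+2` instead of `n ≥ 2m+2`). Written and kernel-checked by theory-2 (gen 26);
split into two files ≤ 400 lines (this PART 1 + `Max/KYSharperLowK` = PART 2, byte-identical declarations, nothing added or removed)
by engine-1 (gen 20) for the tree's file-length rule; mathematics: theory-2 memo `calc33-allm/W1PRIME-NOTES.md` §0–§7 and the
gen-26 notes (NOT IN PRINT). Imports `Max/KYAllMArithmetic` (the partials bound `KYAllM.chooseSqSum`) and Mathlib only; everything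
PROVED; no conjecture of the cell is used or asserted. HONEST FRAMING: arithmetic lemmas serving a LOCATED NEGATIVE about ONE family
of equations (plain Koszul–Young flattenings `Λ^p ⊗ S^k`) for padded permanents; occurrence obstructions are ruled out in print
(BIP'16) — multiplicity obstructions are the open door; nothing here is a claim on VP vs VNP or P vs NP.

**Contents.** The two `c`-dependent determinant-side shapes `KYSharper.chebBound n c k = C(n,k+1)²·C(n²,c+1)` (Chebyshev) and
`KYSharper.tkBound n c k = C(n,k+1)·(n·C(n-1,k)·C(n²,c+1) - C(n-1,k-1)·C(n²,c+2))` (row-mass toolkit; `Max/KYSharperAllM` proves both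
are `≤ n²·LT(n,c,k)`). Writing `N = n²`, `S_k = S(m,k)`, `A = S_k·C(N,c+1)` and `B = S_{k+1}·C(N,c)` (the two low-order upper bounds for
the padded permanent), three GLUE lemmas reduce `B·n² ≤ CHEB`, `A·n² ≤ TK`, `B·n² ≤ TK` to `c`-polynomial CORE inequalities via
`C(N,c+1)(c+1) = C(N,c)(N-c)` (`bcheb_glue`, `atk_glue`, `btk_glue`; the fourth exit `A·n² ≤ CHEB` is not needed here). The cores
are then won from NINE polynomial inequalities in `(m,n)` only — `polyP1`, `polyP4Q`, `polyP5Q` (`k = 1`) and `polyB2/3/4`, `polyA2/3/4` (`k = 2,3,4`) — each proved by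
the substitution `m = s+5`, `2n = 3m+2+t` (for `polyA4`: the parity-resolved `m = 2r+6, n = 3r+10+w` / `m = 2r+5, n = 3r+9+w`), under
which the difference of the two sides is a polynomial in `(s,t)` with NONNEGATIVE rational coefficients (`ring_nf; positivity` over `ℚ`,
binomials cast by `Nat.cast_choose_two` and `castChoose_three/four/five`). Scheme: `k ∈ {2,3,4}`: `c ≤ 6` by `B ≤ CHEB` (`polyB_k`,
monotone in `c`), `c ≥ 7` by `A ≤ TK` (`polyA_k` at `c = 7` and linearity in `c`, `lin_mono`); `k = 1`: `c ≤ 4` by `B ≤ CHEB` (`polyP1`),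
else `A ≤ TK` when its core holds, else `B ≤ TK` by CONCAVITY in `c` of the `B ≤ TK` defect `P(c)` (`concavity_core`, over `ℚ`):
`P(5) ≥ 0` is `polyP5Q`, `P(c⋆) ≥ 0` at the real point `c⋆ = S₁(N+1)/(S₁+S₂) - 1` where `A = B` is `polyP4Q`, and the failed `A ≤ TK`
core forces `c < c⋆`. Main statement `KYSharper.lowK_criterion` = `KYSharper.LowKArithmetic` of `Max/KYSharperAllM` (its hypothesis
`2k+1 ≤ n` is not needed). Exact integer cross-checks preceded the formal proof (theory-2 gen 26, `0` violations): the statement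
itself on every cell `1 ≤ k ≤ 4`, `c < n²`, `⌈3m/2⌉+1 ≤ n ≤ 2m+3` for `5 ≤ m ≤ 16` (198 460 cells), and the nine inequalities for
`m ≤ 120` at every `n ≤ 4m`, for `m ≤ 3000` at sampled `n`.
PART 1 (this file) ends with the nine polynomial inequalities; the `k = 1` concavity argument and the per-`k` assembly
(`lowK_one`, `lowK_of_polys`, main statement `KYSharper.lowK_criterion`) are PART 2 = `Max/KYSharperLowK`.
-/

namespace Summit.PneNP.GCT

namespace KYSharper

open Finset KYAllM


/-! ## The two `c`-dependent determinant-side shapes -/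

/-- Chebyshev form of the leading-term lower bound: `CHEB(n,c,k) = C(n,k+1)²·C(n²,c+1)`. [folklore] -/
def chebBound (n c k : ℕ) : ℕ := (n.choose (k + 1)) ^ 2 * (n * n).choose (c + 1)

/-- Toolkit form of the leading-term lower bound: `TK(n,c,k) = C(n,k+1)·(n·C(n-1,k)·C(n²,c+1) - C(n-1,k-1)·C(n²,c+2))`
(truncated subtraction). [folklore] -/
def tkBound (n c k : ℕ) : ℕ :=
  n.choose (k + 1) * (n * ((n - 1).choose k * (n * n).choose (c + 1)) - (n - 1).choose (k - 1) * (n * n).choose (c + 2))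

/-! ## Glue: from `c`-polynomial core inequalities to `CHEB` / `TK` -/

/-- `B·n² ≤ CHEB` from the core `S·n²·(c+1) ≤ C(n,k+1)²·(N-c)` (`N = n² = c+1+u`). [folklore] -/
lemma bcheb_glue (S n c k u : ℕ) (hu : n * n = c + 1 + u) (h : S * n ^ 2 * (c + 1) ≤ (n.choose (k + 1)) ^ 2 * (u + 1)) :
    S * (n * n).choose c * n ^ 2 ≤ chebBound n c k := by
  unfold chebBound
  have hid : (n * n).choose (c + 1) * (c + 1) = (n * n).choose c * (u + 1) := by
    rw [Nat.choose_succ_right_eq, show n * n - c = u + 1 by omega]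
  refine Nat.le_of_mul_le_mul_right ?_ (Nat.succ_pos c)
  calc S * (n * n).choose c * n ^ 2 * (c + 1) = (n * n).choose c * (S * n ^ 2 * (c + 1)) := by ring
    _ ≤ (n * n).choose c * ((n.choose (k + 1)) ^ 2 * (u + 1)) := Nat.mul_le_mul_left _ h
    _ = (n.choose (k + 1)) ^ 2 * ((n * n).choose c * (u + 1)) := by ring
    _ = (n.choose (k + 1)) ^ 2 * (n * n).choose (c + 1) * (c + 1) := by rw [← hid]; ring

/-- `A·n² ≤ TK` from the core `(c+2)·S·n² + C(n,k+1)·C(n-1,k-1)·(N+1) ≤ (c+2)·C(n,k+1)·(n·C(n-1,k) + C(n-1,k-1))`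
(multiply by `C(N,c+1)` and use `C(N,c+2)(c+2) = C(N,c+1)(N-c-1)`). [folklore] -/
lemma atk_glue (S n c k u : ℕ) (hu : n * n = c + 1 + u)
    (h : (c + 2) * (S * n ^ 2) + n.choose (k + 1) * (n - 1).choose (k - 1) * (n * n + 1)
      ≤ (c + 2) * (n.choose (k + 1) * (n * (n - 1).choose k + (n - 1).choose (k - 1)))) :
    S * (n * n).choose (c + 1) * n ^ 2 ≤ tkBound n c k := by
  unfold tkBound
  set a := n.choose (k + 1)
  set b := (n - 1).choose (k - 1)
  set e := (n - 1).choose k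
  set B1 := (n * n).choose (c + 1)
  set B2 := (n * n).choose (c + 2)
  have hid : B2 * (c + 2) = B1 * u := by
    have h2 := Nat.choose_succ_right_eq (n * n) (c + 1)
    rwa [show n * n - (c + 1) = u by omega] at h2
  have e1 : a * b * (n * n + 1) = a * b * u + a * b * (c + 2) := by rw [hu]; ring
  have e2 : (c + 2) * (a * (n * e + b)) = (c + 2) * (a * (n * e)) + a * b * (c + 2) := by ring
  have h1 : (c + 2) * (S * n ^ 2) + a * b * u ≤ (c + 2) * (a * (n * e)) := by
    rw [e1, e2, ← add_assoc] at h
    exact Nat.le_of_add_le_add_right h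
  have h2 : (S * B1 * n ^ 2 + a * (b * B2)) * (c + 2) ≤ a * (n * (e * B1)) * (c + 2) := by
    calc (S * B1 * n ^ 2 + a * (b * B2)) * (c + 2) = B1 * ((c + 2) * (S * n ^ 2)) + a * b * (B2 * (c + 2)) := by ring
      _ = B1 * ((c + 2) * (S * n ^ 2)) + a * b * (B1 * u) := by rw [hid]
      _ = B1 * ((c + 2) * (S * n ^ 2) + a * b * u) := by ring
      _ ≤ B1 * ((c + 2) * (a * (n * e))) := Nat.mul_le_mul_left _ h1
      _ = a * (n * (e * B1)) * (c + 2) := by ring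
  have h3 := Nat.le_of_mul_le_mul_right h2 (by omega : 0 < c + 2)
  rw [Nat.mul_sub]
  exact Nat.le_sub_of_add_le h3

/-- `B·n² ≤ TK` from the core `S·n²·(c+1)(c+2) + C(n,k+1)·C(n-1,k-1)·(N-c)(N-c-1) ≤ C(n,k+1)·n·C(n-1,k)·(N-c)·(c+2)`
(multiply by `C(N,c)` and use `C(N,c+1)(c+1) = C(N,c)(N-c)`, `C(N,c+2)(c+2) = C(N,c+1)(N-c-1)`). [folklore] -/
lemma btk_glue (S n c k u : ℕ) (hu : n * n = c + 1 + u)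
    (h : S * n ^ 2 * (c + 1) * (c + 2) + n.choose (k + 1) * (n - 1).choose (k - 1) * (u + 1) * u
      ≤ n.choose (k + 1) * n * (n - 1).choose k * (u + 1) * (c + 2)) :
    S * (n * n).choose c * n ^ 2 ≤ tkBound n c k := by
  unfold tkBound
  set a := n.choose (k + 1)
  set b := (n - 1).choose (k - 1)
  set e := (n - 1).choose k
  set B0 := (n * n).choose c
  set B1 := (n * n).choose (c + 1)
  set B2 := (n * n).choose (c + 2)
  have hid1 : B1 * (c + 1) = B0 * (u + 1) := by
    have h1 := Nat.choose_succ_right_eq (n * n) c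
    rwa [show n * n - c = u + 1 by omega] at h1
  have hid2 : B2 * (c + 2) = B1 * u := by
    have h2 := Nat.choose_succ_right_eq (n * n) (c + 1)
    rwa [show n * n - (c + 1) = u by omega] at h2
  have h2 : (S * B0 * n ^ 2 + a * (b * B2)) * ((c + 1) * (c + 2)) ≤ a * (n * (e * B1)) * ((c + 1) * (c + 2)) := by
    calc (S * B0 * n ^ 2 + a * (b * B2)) * ((c + 1) * (c + 2))
          = B0 * (S * n ^ 2 * (c + 1) * (c + 2)) + a * b * (B2 * (c + 2)) * (c + 1) := by ring
      _ = B0 * (S * n ^ 2 * (c + 1) * (c + 2)) + a * b * (B1 * u) * (c + 1) := by rw [hid2]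
      _ = B0 * (S * n ^ 2 * (c + 1) * (c + 2)) + a * b * u * (B1 * (c + 1)) := by ring
      _ = B0 * (S * n ^ 2 * (c + 1) * (c + 2)) + a * b * u * (B0 * (u + 1)) := by rw [hid1]
      _ = B0 * (S * n ^ 2 * (c + 1) * (c + 2) + a * b * (u + 1) * u) := by ring
      _ ≤ B0 * (a * n * e * (u + 1) * (c + 2)) := Nat.mul_le_mul_left _ h
      _ = a * (n * (e * (B0 * (u + 1)))) * (c + 2) := by ring
      _ = a * (n * (e * (B1 * (c + 1)))) * (c + 2) := by rw [hid1]
      _ = a * (n * (e * B1)) * ((c + 1) * (c + 2)) := by ring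
  have h3 := Nat.le_of_mul_le_mul_right h2 (by positivity : 0 < (c + 1) * (c + 2))
  rw [Nat.mul_sub]
  exact Nat.le_sub_of_add_le h3

/-- The four exits: any one of `A·n² ≤ CHEB`, `A·n² ≤ TK`, `B·n² ≤ CHEB`, `B·n² ≤ TK` gives `min(A,B)·n² ≤ max(CHEB,TK)`. [folklore] -/
lemma min_mul_le_max {A B t x y : ℕ} (h : A * t ≤ x ∨ A * t ≤ y ∨ B * t ≤ x ∨ B * t ≤ y) : min A B * t ≤ max x y := by
  have hA : min A B * t ≤ A * t := Nat.mul_le_mul_right _ (min_le_left _ _)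
  have hB : min A B * t ≤ B * t := Nat.mul_le_mul_right _ (min_le_right _ _)
  rcases h with h | h | h | h
  · exact (hA.trans h).trans (le_max_left _ _)
  · exact (hA.trans h).trans (le_max_right _ _)
  · exact (hB.trans h).trans (le_max_left _ _)
  · exact (hB.trans h).trans (le_max_right _ _)

/-- Linearity in `c` of the `A ≤ TK` core: `x₀·α + β ≤ x₀·γ`, `α ≤ γ`, `x₀ ≤ x` give `x·α + β ≤ x·γ`. [folklore] -/
lemma lin_mono (α β γ x₀ x : ℕ) (h : x₀ * α + β ≤ x₀ * γ) (hαγ : α ≤ γ) (hx : x₀ ≤ x) : x * α + β ≤ x * γ := by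
  obtain ⟨d, rfl⟩ := Nat.exists_eq_add_of_le hx
  calc (x₀ + d) * α + β = (x₀ * α + β) + d * α := by ring
    _ ≤ x₀ * γ + d * γ := Nat.add_le_add h (Nat.mul_le_mul_left d hαγ)
    _ = (x₀ + d) * γ := by ring

/-! ## Casts of small binomials and unfoldings of `S(m,k)`, `k ≤ 5` -/

/-- `C(x,3) = x(x-1)(x-2)/6` in `ℚ`. [folklore] -/
lemma castChoose_three (x : ℕ) : ((x.choose 3 : ℕ) : ℚ) = x * (x - 1) * (x - 2) / 6 := by
  induction x with
  | zero => simp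
  | succ x ih =>
    rw [Nat.choose_succ_succ', Nat.cast_add, ih, Nat.cast_choose_two]
    push_cast; ring

/-- `C(x,4) = x(x-1)(x-2)(x-3)/24` in `ℚ`. [folklore] -/
lemma castChoose_four (x : ℕ) : ((x.choose 4 : ℕ) : ℚ) = x * (x - 1) * (x - 2) * (x - 3) / 24 := by
  induction x with
  | zero => simp
  | succ x ih =>
    rw [Nat.choose_succ_succ', Nat.cast_add, ih, castChoose_three]
    push_cast; ring

/-- `C(x,5) = x(x-1)(x-2)(x-3)(x-4)/120` in `ℚ`. [folklore] -/
lemma castChoose_five (x : ℕ) : ((x.choose 5 : ℕ) : ℚ) = x * (x - 1) * (x - 2) * (x - 3) * (x - 4) / 120 := by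
  induction x with
  | zero => simp
  | succ x ih =>
    rw [Nat.choose_succ_succ', Nat.cast_add, ih, castChoose_four]
    push_cast; ring

/-- `S(m,3) = 1 + m² + C(m,2)² + C(m,3)²`. [folklore] -/
lemma chooseSqSum_three (m : ℕ) : chooseSqSum m 3 = 1 + m ^ 2 + (m.choose 2) ^ 2 + (m.choose 3) ^ 2 := by
  rw [chooseSqSum_succ, chooseSqSum_two]

/-- `S(m,4) = 1 + m² + C(m,2)² + C(m,3)² + C(m,4)²`. [folklore] -/
lemma chooseSqSum_four (m : ℕ) :
    chooseSqSum m 4 = 1 + m ^ 2 + (m.choose 2) ^ 2 + (m.choose 3) ^ 2 + (m.choose 4) ^ 2 := by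
  rw [chooseSqSum_succ, chooseSqSum_three]

/-- `S(m,5) = 1 + m² + C(m,2)² + C(m,3)² + C(m,4)² + C(m,5)²`. [folklore] -/
lemma chooseSqSum_five (m : ℕ) :
    chooseSqSum m 5 = 1 + m ^ 2 + (m.choose 2) ^ 2 + (m.choose 3) ^ 2 + (m.choose 4) ^ 2 + (m.choose 5) ^ 2 := by
  rw [chooseSqSum_succ, chooseSqSum_four]

/-- The substitution `2n = 3m+2+t`, `m = s+5`, in `ℚ`. [folklore] -/
lemma cast_n_eq (s n t : ℕ) (ht : 2 * n = 3 * (s + 5) + 2 + t) : (n : ℚ) = (3 * ((s : ℚ) + 5) + 2 + t) / 2 := by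
  have h : ((2 * n : ℕ) : ℚ) = ((3 * (s + 5) + 2 + t : ℕ) : ℚ) := by rw [ht]
  push_cast at h ⊢
  linarith

/-! ## The nine polynomial inequalities (`m ≥ 5`, `2n ≥ 3m+2`; manifestly positive after `m = s+5`, `2n = 3m+2+t`) -/

/-- `P1` (`k = 1`, `B ≤ CHEB` up to `c = 4`): `5·S₂·n² + 4·C(n,2)² ≤ C(n,2)²·n²`. [folklore] -/
theorem polyP1 (m n : ℕ) (hm : 5 ≤ m) (hn : 3 * m + 2 ≤ 2 * n) :
    5 * (chooseSqSum m 2 * n ^ 2) + 4 * (n.choose 2) ^ 2 ≤ (n.choose 2) ^ 2 * (n * n) := by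
  obtain ⟨s, rfl⟩ : ∃ s, m = s + 5 := ⟨m - 5, by omega⟩
  obtain ⟨t, ht⟩ : ∃ t, 2 * n = 3 * (s + 5) + 2 + t := ⟨2 * n - (3 * (s + 5) + 2), by omega⟩
  have hnq := cast_n_eq s n t ht
  rw [chooseSqSum_two]
  have key : ((5 * ((1 + (s + 5) ^ 2 + ((s + 5).choose 2) ^ 2) * n ^ 2) + 4 * (n.choose 2) ^ 2 : ℕ) : ℚ)
      ≤ (((n.choose 2) ^ 2 * (n * n) : ℕ) : ℚ) := by
    push_cast
    simp only [Nat.cast_choose_two]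
    push_cast
    rw [hnq, ← sub_nonneg]
    ring_nf
    positivity
  exact_mod_cast key

/-- `P4` (`k = 1`, the `A ≤ TK` core at the real crossing point `c⋆`, cleared of denominators), in `ℚ`:
`(S₁(N+2)+S₂)·S₁N + C(n,2)(N+1)(S₁+S₂) ≤ (S₁(N+2)+S₂)·C(n,2)(N-n+1)`, `N = n²`. [folklore] -/
theorem polyP4Q (m n : ℕ) (hm : 5 ≤ m) (hn : 3 * m + 2 ≤ 2 * n) :
    ((chooseSqSum m 1 : ℕ) * ((n : ℚ) ^ 2 + 2) + (chooseSqSum m 2 : ℕ)) * ((chooseSqSum m 1 : ℕ) * (n : ℚ) ^ 2)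
        + (n.choose 2 : ℕ) * ((n : ℚ) ^ 2 + 1) * ((chooseSqSum m 1 : ℕ) + (chooseSqSum m 2 : ℕ))
      ≤ ((chooseSqSum m 1 : ℕ) * ((n : ℚ) ^ 2 + 2) + (chooseSqSum m 2 : ℕ)) * ((n.choose 2 : ℕ) * ((n : ℚ) ^ 2 - n + 1)) := by
  obtain ⟨s, rfl⟩ : ∃ s, m = s + 5 := ⟨m - 5, by omega⟩
  obtain ⟨t, ht⟩ : ∃ t, 2 * n = 3 * (s + 5) + 2 + t := ⟨2 * n - (3 * (s + 5) + 2), by omega⟩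
  have hnq := cast_n_eq s n t ht
  rw [chooseSqSum_one, chooseSqSum_two]
  push_cast
  simp only [Nat.cast_choose_two]
  push_cast
  rw [hnq, ← sub_nonneg]
  ring_nf
  positivity

/-- `P5` (`k = 1`, the `B ≤ TK` core at `c = 5`), in `ℚ`: `42·S₂·n² ≤ C(n,2)·(n²-5)·(6n²-7n+6)`. [folklore] -/
theorem polyP5Q (m n : ℕ) (hm : 5 ≤ m) (hn : 3 * m + 2 ≤ 2 * n) :
    42 * ((chooseSqSum m 2 : ℕ) : ℚ) * (n : ℚ) ^ 2 ≤ (n.choose 2 : ℕ) * ((n : ℚ) ^ 2 - 5) * (6 * (n : ℚ) ^ 2 - 7 * n + 6) := by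
  obtain ⟨s, rfl⟩ : ∃ s, m = s + 5 := ⟨m - 5, by omega⟩
  obtain ⟨t, ht⟩ : ∃ t, 2 * n = 3 * (s + 5) + 2 + t := ⟨2 * n - (3 * (s + 5) + 2), by omega⟩
  have hnq := cast_n_eq s n t ht
  rw [chooseSqSum_two]
  push_cast
  simp only [Nat.cast_choose_two]
  push_cast
  rw [hnq, ← sub_nonneg]
  ring_nf
  positivity

/-- `B2` (`k = 2`, `B ≤ CHEB` up to `c = 6`): `7·S₃·n² + 6·C(n,3)² ≤ C(n,3)²·n²`. [folklore] -/
theorem polyB2 (m n : ℕ) (hm : 5 ≤ m) (hn : 3 * m + 2 ≤ 2 * n) :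
    7 * (chooseSqSum m 3 * n ^ 2) + 6 * (n.choose 3) ^ 2 ≤ (n.choose 3) ^ 2 * (n * n) := by
  obtain ⟨s, rfl⟩ : ∃ s, m = s + 5 := ⟨m - 5, by omega⟩
  obtain ⟨t, ht⟩ : ∃ t, 2 * n = 3 * (s + 5) + 2 + t := ⟨2 * n - (3 * (s + 5) + 2), by omega⟩
  have hnq := cast_n_eq s n t ht
  rw [chooseSqSum_three]
  have key : ((7 * ((1 + (s + 5) ^ 2 + ((s + 5).choose 2) ^ 2 + ((s + 5).choose 3) ^ 2) * n ^ 2) + 6 * (n.choose 3) ^ 2 : ℕ) : ℚ)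
      ≤ (((n.choose 3) ^ 2 * (n * n) : ℕ) : ℚ) := by
    push_cast
    simp only [Nat.cast_choose_two, castChoose_three]
    push_cast
    rw [hnq, ← sub_nonneg]
    ring_nf
    positivity
  exact_mod_cast key

/-- `B3` (`k = 3`, `B ≤ CHEB` up to `c = 6`): `7·S₄·n² + 6·C(n,4)² ≤ C(n,4)²·n²`. [folklore] -/
theorem polyB3 (m n : ℕ) (hm : 5 ≤ m) (hn : 3 * m + 2 ≤ 2 * n) :
    7 * (chooseSqSum m 4 * n ^ 2) + 6 * (n.choose 4) ^ 2 ≤ (n.choose 4) ^ 2 * (n * n) := by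
  obtain ⟨s, rfl⟩ : ∃ s, m = s + 5 := ⟨m - 5, by omega⟩
  obtain ⟨t, ht⟩ : ∃ t, 2 * n = 3 * (s + 5) + 2 + t := ⟨2 * n - (3 * (s + 5) + 2), by omega⟩
  have hnq := cast_n_eq s n t ht
  rw [chooseSqSum_four]
  have key : ((7 * ((1 + (s + 5) ^ 2 + ((s + 5).choose 2) ^ 2 + ((s + 5).choose 3) ^ 2 + ((s + 5).choose 4) ^ 2) * n ^ 2)
      + 6 * (n.choose 4) ^ 2 : ℕ) : ℚ) ≤ (((n.choose 4) ^ 2 * (n * n) : ℕ) : ℚ) := by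
    push_cast
    simp only [Nat.cast_choose_two, castChoose_three, castChoose_four]
    push_cast
    rw [hnq, ← sub_nonneg]
    ring_nf
    positivity
  exact_mod_cast key

/-- `B4` (`k = 4`, `B ≤ CHEB` up to `c = 6`): `7·S₅·n² + 6·C(n,5)² ≤ C(n,5)²·n²`. [folklore] -/
theorem polyB4 (m n : ℕ) (hm : 5 ≤ m) (hn : 3 * m + 2 ≤ 2 * n) :
    7 * (chooseSqSum m 5 * n ^ 2) + 6 * (n.choose 5) ^ 2 ≤ (n.choose 5) ^ 2 * (n * n) := by
  obtain ⟨s, rfl⟩ : ∃ s, m = s + 5 := ⟨m - 5, by omega⟩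
  obtain ⟨t, ht⟩ : ∃ t, 2 * n = 3 * (s + 5) + 2 + t := ⟨2 * n - (3 * (s + 5) + 2), by omega⟩
  have hnq := cast_n_eq s n t ht
  rw [chooseSqSum_five]
  have key : ((7 * ((1 + (s + 5) ^ 2 + ((s + 5).choose 2) ^ 2 + ((s + 5).choose 3) ^ 2 + ((s + 5).choose 4) ^ 2
      + ((s + 5).choose 5) ^ 2) * n ^ 2) + 6 * (n.choose 5) ^ 2 : ℕ) : ℚ) ≤ (((n.choose 5) ^ 2 * (n * n) : ℕ) : ℚ) := by
    push_cast
    simp only [Nat.cast_choose_two, castChoose_three, castChoose_four, castChoose_five]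
    push_cast
    rw [hnq, ← sub_nonneg]
    ring_nf
    positivity
  exact_mod_cast key

/-- `A2` (`k = 2`, the `A ≤ TK` core at `c = 7`): `9·S₂·n² + C(n,3)·C(n-1,1)·(n²+1) ≤ 9·C(n,3)·(n·C(n-1,2) + C(n-1,1))`.
[folklore] -/
theorem polyA2 (m n : ℕ) (hm : 5 ≤ m) (hn : 3 * m + 2 ≤ 2 * n) :
    9 * (chooseSqSum m 2 * n ^ 2) + n.choose 3 * (n - 1).choose 1 * (n * n + 1)
      ≤ 9 * (n.choose 3 * (n * (n - 1).choose 2 + (n - 1).choose 1)) := by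
  obtain ⟨s, rfl⟩ : ∃ s, m = s + 5 := ⟨m - 5, by omega⟩
  obtain ⟨v, rfl⟩ : ∃ v, n = v + 1 := ⟨n - 1, by omega⟩
  obtain ⟨t, ht⟩ : ∃ t, 2 * (v + 1) = 3 * (s + 5) + 2 + t := ⟨2 * (v + 1) - (3 * (s + 5) + 2), by omega⟩
  have hvq : (v : ℚ) = (3 * ((s : ℚ) + 5) + t) / 2 := by have h := cast_n_eq s (v + 1) t ht; push_cast at h; linarith
  simp only [Nat.add_sub_cancel]
  rw [chooseSqSum_two]
  have key : ((9 * ((1 + (s + 5) ^ 2 + ((s + 5).choose 2) ^ 2) * (v + 1) ^ 2)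
      + (v + 1).choose 3 * v.choose 1 * ((v + 1) * (v + 1) + 1) : ℕ) : ℚ)
      ≤ ((9 * ((v + 1).choose 3 * ((v + 1) * v.choose 2 + v.choose 1)) : ℕ) : ℚ) := by
    push_cast
    simp only [Nat.cast_choose_two, castChoose_three, Nat.choose_one_right]
    push_cast
    rw [hvq, ← sub_nonneg]
    ring_nf
    positivity
  exact_mod_cast key

/-- `A3` (`k = 3`, the `A ≤ TK` core at `c = 7`): `9·S₃·n² + C(n,4)·C(n-1,2)·(n²+1) ≤ 9·C(n,4)·(n·C(n-1,3) + C(n-1,2))`.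
[folklore] -/
theorem polyA3 (m n : ℕ) (hm : 5 ≤ m) (hn : 3 * m + 2 ≤ 2 * n) :
    9 * (chooseSqSum m 3 * n ^ 2) + n.choose 4 * (n - 1).choose 2 * (n * n + 1)
      ≤ 9 * (n.choose 4 * (n * (n - 1).choose 3 + (n - 1).choose 2)) := by
  obtain ⟨s, rfl⟩ : ∃ s, m = s + 5 := ⟨m - 5, by omega⟩
  obtain ⟨v, rfl⟩ : ∃ v, n = v + 1 := ⟨n - 1, by omega⟩
  obtain ⟨t, ht⟩ : ∃ t, 2 * (v + 1) = 3 * (s + 5) + 2 + t := ⟨2 * (v + 1) - (3 * (s + 5) + 2), by omega⟩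
  have hvq : (v : ℚ) = (3 * ((s : ℚ) + 5) + t) / 2 := by have h := cast_n_eq s (v + 1) t ht; push_cast at h; linarith
  simp only [Nat.add_sub_cancel]
  rw [chooseSqSum_three]
  have key : ((9 * ((1 + (s + 5) ^ 2 + ((s + 5).choose 2) ^ 2 + ((s + 5).choose 3) ^ 2) * (v + 1) ^ 2)
      + (v + 1).choose 4 * v.choose 2 * ((v + 1) * (v + 1) + 1) : ℕ) : ℚ)
      ≤ ((9 * ((v + 1).choose 4 * ((v + 1) * v.choose 3 + v.choose 2)) : ℕ) : ℚ) := by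
    push_cast
    simp only [Nat.cast_choose_two, castChoose_three, castChoose_four]
    push_cast
    rw [hvq, ← sub_nonneg]
    ring_nf
    positivity
  exact_mod_cast key

/-- `A4` (`k = 4`, the `A ≤ TK` core at `c = 7`): `9·S₄·n² + C(n,5)·C(n-1,3)·(n²+1) ≤ 9·C(n,5)·(n·C(n-1,4) + C(n-1,3))`.
Here the half-integral substitution leaves two negative low-order coefficients, so the parity of `m` is resolved first:
`m = 2r+6, n = 3r+10+w` resp. `m = 2r+5, n = 3r+9+w`. [folklore] -/
theorem polyA4 (m n : ℕ) (hm : 5 ≤ m) (hn : 3 * m + 2 ≤ 2 * n) :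
    9 * (chooseSqSum m 4 * n ^ 2) + n.choose 5 * (n - 1).choose 3 * (n * n + 1)
      ≤ 9 * (n.choose 5 * (n * (n - 1).choose 4 + (n - 1).choose 3)) := by
  obtain ⟨v, rfl⟩ : ∃ v, n = v + 1 := ⟨n - 1, by omega⟩
  simp only [Nat.add_sub_cancel]
  rw [chooseSqSum_four]
  rcases Nat.even_or_odd' m with ⟨r, hr | hr⟩
  · -- `m = 2r` even, `r ≥ 3`
    obtain ⟨r, rfl⟩ : ∃ r', r = r' + 3 := ⟨r - 3, by omega⟩
    subst hr
    obtain ⟨w, rfl⟩ : ∃ w, v = 3 * r + 9 + w := ⟨v - (3 * r + 9), by omega⟩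
    have key : ((9 * ((1 + (2 * (r + 3)) ^ 2 + ((2 * (r + 3)).choose 2) ^ 2 + ((2 * (r + 3)).choose 3) ^ 2
        + ((2 * (r + 3)).choose 4) ^ 2) * (3 * r + 9 + w + 1) ^ 2)
        + (3 * r + 9 + w + 1).choose 5 * (3 * r + 9 + w).choose 3 * ((3 * r + 9 + w + 1) * (3 * r + 9 + w + 1) + 1)
        : ℕ) : ℚ)
        ≤ ((9 * ((3 * r + 9 + w + 1).choose 5 * ((3 * r + 9 + w + 1) * (3 * r + 9 + w).choose 4
          + (3 * r + 9 + w).choose 3)) : ℕ) : ℚ) := by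
      push_cast
      simp only [Nat.cast_choose_two, castChoose_three, castChoose_four, castChoose_five]
      push_cast
      rw [← sub_nonneg]
      ring_nf
      positivity
    exact_mod_cast key
  · -- `m = 2r+1` odd, `r ≥ 2`
    obtain ⟨r, rfl⟩ : ∃ r', r = r' + 2 := ⟨r - 2, by omega⟩
    subst hr
    obtain ⟨w, rfl⟩ : ∃ w, v = 3 * r + 8 + w := ⟨v - (3 * r + 8), by omega⟩
    have key : ((9 * ((1 + (2 * (r + 2) + 1) ^ 2 + ((2 * (r + 2) + 1).choose 2) ^ 2
        + ((2 * (r + 2) + 1).choose 3) ^ 2 + ((2 * (r + 2) + 1).choose 4) ^ 2) * (3 * r + 8 + w + 1) ^ 2)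
        + (3 * r + 8 + w + 1).choose 5 * (3 * r + 8 + w).choose 3 * ((3 * r + 8 + w + 1) * (3 * r + 8 + w + 1) + 1)
        : ℕ) : ℚ)
        ≤ ((9 * ((3 * r + 8 + w + 1).choose 5 * ((3 * r + 8 + w + 1) * (3 * r + 8 + w).choose 4
          + (3 * r + 8 + w).choose 3)) : ℕ) : ℚ) := by
      push_cast
      simp only [Nat.cast_choose_two, castChoose_three, castChoose_four, castChoose_five]
      push_cast
      rw [← sub_nonneg]
      ring_nf
      positivity
    exact_mod_cast key

end KYSharper

end Summit.PneNP.GCT
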